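import Mathlib
import HarnessLib

/-!
# Route `KLProgramme` — engine support, route (L2), FAT layer 5b: scalar inequalities for the closed form of `α_n` — the weight sum `W`,
# the support count `N̄_s`, and the final product `√W·√(16·2M·L²·N̄_s)·A₀ ≤ C·(M/β)/Λ`

Cell `gate-hubbard-kl`, seat hubbard-kl-k3c2-p3; gen-4 ENGINE child stmt-HubbardSuperconductivity-19855 (`stub_engine_step_norms`, `α_n`).
Companion of `…AlphaFatScalars`: with the canonical rates (`1/s₀ = x₀(M/β)/Λ`, `1/s₁ = x₁/Λ`, `1/(s₂(N_r−1)) ≤ x₂/Λ`, `1/(s₃(N_r−1)) ≤ x₃N_r`)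
the additive weight sum is `W ≤ 4096·x₀·C_b·(M/β)·N_r/Λ²` (far term via `δ_L ≤ Λ²L`, `L/(10N_r) ≤ R₀`), the fat support count is
`N̄_s ≤ C_N·βL²Λ²/N_r`, and the per-pair bound collapses to `T ≤ 4√(2·x₀C_bC_N')·(M/β)/Λ` — `N_r` cancels.  Pure real algebra. [folklore]
-/

noncomputable section

namespace Summit.HubbardSuperconductivity.HubbardSuperconductivity.Theorems.TorusFourierL2

set_option linter.dupNamespace false -- summit = problem name (single-conjunct summit), D-0017

/-- **The Euclidean tangential datum of the slice profile along the tangent step**: `ℓ₁(4+2A) + K₂(√2ρ_f)(√2ℓ) ≤ (ℓ/N_r)(4+2A+2K₂c_ρπ)`.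
[folklore] -/
theorem tangentTau_le {A K₂ ρf ℓ l1 cρ Nr : ℝ} (hA : 0 ≤ A) (hK₂ : 0 ≤ K₂) (hℓ : 0 ≤ ℓ) (hNr : 0 < Nr) (hl1 : l1 ≤ ℓ / Nr)
    (hρfb : ρf ≤ cρ * Real.pi / Nr) :
    l1 * (4 + 2 * A) + K₂ * (Real.sqrt 2 * ρf) * (Real.sqrt 2 * ℓ) ≤ ℓ / Nr * (4 + 2 * A + 2 * K₂ * (cρ * Real.pi)) := by
  have hs2 : Real.sqrt 2 * Real.sqrt 2 = 2 := Real.mul_self_sqrt (by norm_num)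
  have e : K₂ * (Real.sqrt 2 * ρf) * (Real.sqrt 2 * ℓ) = 2 * K₂ * ρf * ℓ := by
    calc K₂ * (Real.sqrt 2 * ρf) * (Real.sqrt 2 * ℓ) = (Real.sqrt 2 * Real.sqrt 2) * K₂ * ρf * ℓ := by ring
      _ = 2 * K₂ * ρf * ℓ := by rw [hs2]
  rw [e]
  have h1 : l1 * (4 + 2 * A) ≤ ℓ / Nr * (4 + 2 * A) := mul_le_mul_of_nonneg_right hl1 (by positivity)
  have h2 : 2 * K₂ * ρf * ℓ ≤ 2 * K₂ * (cρ * Real.pi / Nr) * ℓ :=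
    mul_le_mul_of_nonneg_right (mul_le_mul_of_nonneg_left hρfb (by positivity)) hℓ
  have e2 : ℓ / Nr * (4 + 2 * A + 2 * K₂ * (cρ * Real.pi)) = ℓ / Nr * (4 + 2 * A) + 2 * K₂ * (cρ * Real.pi / Nr) * ℓ := by
    field_simp
  rw [e2]; exact add_le_add h1 h2

/-- **The additive weight sum with canonical rates**: if `1/s₀ = x₀(M/β)/Λ ≥ 1`, `1/s₁ = x₁/Λ`, `1/(s₂(N_r−1)) ≤ x₂/Λ`,
`1/(s₃(N_r−1)) ≤ x₃N_r`, `Λ ≤ e₀ ≤ 1`, `N_r ≥ 2`, `δ_L ≤ Λ²L`, `L/(10N_r) ≤ R₀`, then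
`W ≤ 4096·x₀·(4(2√2x₂+2)(2√2x₃+1) + 160x₁(x₁+1)²/δ_L)·(M/β)·N_r/Λ²`. [folklore] -/
theorem wBracket_le {s₀ s₁ s₂ s₃ Nr R₀ Λ e₀ Mβ x₀ x₁ x₂ x₃ δL L : ℝ} (hs₀ : 0 < s₀) (hs₁ : 0 < s₁) (hs₂ : 0 < s₂) (hs₃ : 0 < s₃)
    (hΛ : 0 < Λ) (hΛe : Λ ≤ e₀) (he₁ : e₀ ≤ 1) (hNr : 2 ≤ Nr) (hMβ : 0 ≤ Mβ) (hx₀ : 0 ≤ x₀) (hx₂ : 0 ≤ x₂) (hx₃ : 0 ≤ x₃)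
    (hδL : 0 < δL) (hL : 0 < L)
    (h0 : 1 / s₀ = x₀ * Mβ / Λ) (h0' : 1 ≤ 1 / s₀) (h1 : 1 / s₁ = x₁ / Λ)
    (h2 : 1 / (s₂ * (Nr - 1)) ≤ x₂ / Λ) (h3 : 1 / (s₃ * (Nr - 1)) ≤ x₃ * Nr) (hΛL : δL ≤ Λ ^ 2 * L) (hR₀ : L / (10 * Nr) ≤ R₀) :
    2048 * (1 / s₀ + 1) *
        (4 * ((2 * Real.sqrt 2 / (s₂ * (Nr - 1)) + 2) * (2 * Real.sqrt 2 / (s₃ * (Nr - 1)) + 2)) + 16 * (1 / s₁ + 1) ^ 2 / (1 + s₁ * R₀)) ≤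
      4096 * x₀ * (4 * ((2 * Real.sqrt 2 * x₂ + 2) * (2 * Real.sqrt 2 * x₃ + 1)) + 160 * x₁ * (x₁ + 1) ^ 2 / δL) * Mβ * Nr / Λ ^ 2 := by
  have hNr1 : 0 < Nr - 1 := by linarith
  have hNr0 : 0 < Nr := by linarith
  have hs2 : 0 ≤ Real.sqrt 2 := Real.sqrt_nonneg 2
  -- the prefactor
  have hpre : 1 / s₀ + 1 ≤ 2 * (x₀ * Mβ / Λ) := by rw [← h0]; linarith
  have hpre0 : 0 ≤ 1 / s₀ + 1 := by positivity
  -- the near bracket: `2√2/(s₂(Nr−1)) + 2 ≤ (2√2x₂ + 2)/Λ` and `2√2/(s₃(Nr−1)) + 2 ≤ (2√2x₃ + 1)·Nr`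
  have hΛ1 : Λ ≤ 1 := hΛe.trans he₁
  have hA : 2 * Real.sqrt 2 / (s₂ * (Nr - 1)) + 2 ≤ (2 * Real.sqrt 2 * x₂ + 2) / Λ := by
    have e1 : 2 * Real.sqrt 2 / (s₂ * (Nr - 1)) = 2 * Real.sqrt 2 * (1 / (s₂ * (Nr - 1))) := by ring
    rw [e1, add_div]
    refine add_le_add ?_ ?_
    · rw [mul_div_assoc]; exact mul_le_mul_of_nonneg_left h2 (by positivity)
    · rw [le_div_iff₀ hΛ]; nlinarith
  have hA0 : 0 ≤ 2 * Real.sqrt 2 / (s₂ * (Nr - 1)) + 2 := by positivity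
  have hB : 2 * Real.sqrt 2 / (s₃ * (Nr - 1)) + 2 ≤ (2 * Real.sqrt 2 * x₃ + 1) * Nr := by
    have e1 : 2 * Real.sqrt 2 / (s₃ * (Nr - 1)) = 2 * Real.sqrt 2 * (1 / (s₃ * (Nr - 1))) := by ring
    rw [e1]
    have := mul_le_mul_of_nonneg_left h3 (by positivity : 0 ≤ 2 * Real.sqrt 2)
    nlinarith
  have hB0 : 0 ≤ 2 * Real.sqrt 2 / (s₃ * (Nr - 1)) + 2 := by positivity
  have hnear : 4 * ((2 * Real.sqrt 2 / (s₂ * (Nr - 1)) + 2) * (2 * Real.sqrt 2 / (s₃ * (Nr - 1)) + 2)) ≤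
      4 * ((2 * Real.sqrt 2 * x₂ + 2) * (2 * Real.sqrt 2 * x₃ + 1)) * Nr / Λ := by
    have := mul_le_mul hA hB hB0 (by positivity)
    calc 4 * ((2 * Real.sqrt 2 / (s₂ * (Nr - 1)) + 2) * (2 * Real.sqrt 2 / (s₃ * (Nr - 1)) + 2))
        ≤ 4 * ((2 * Real.sqrt 2 * x₂ + 2) / Λ * ((2 * Real.sqrt 2 * x₃ + 1) * Nr)) := by gcongr
      _ = 4 * ((2 * Real.sqrt 2 * x₂ + 2) * (2 * Real.sqrt 2 * x₃ + 1)) * Nr / Λ := by field_simp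
  -- the far term: `16(1/s₁+1)²/(1+s₁R₀) ≤ 160 x₁(x₁+1)² Nr/(δL Λ)`
  have hs₁eq : s₁ = Λ / x₁ := by
    have hx₁0 : 0 < x₁ := by
      by_contra h; push Not at h
      have : 1 / s₁ ≤ 0 := by rw [h1]; exact div_nonpos_of_nonpos_of_nonneg h hΛ.le
      linarith [one_div_pos.2 hs₁]
    field_simp at h1 ⊢; linarith
  have hx₁0 : 0 < x₁ := by
    by_contra h; push Not at h
    have : 1 / s₁ ≤ 0 := by rw [h1]; exact div_nonpos_of_nonpos_of_nonneg h hΛ.le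
    linarith [one_div_pos.2 hs₁]
  have hfar : 16 * (1 / s₁ + 1) ^ 2 / (1 + s₁ * R₀) ≤ 160 * x₁ * (x₁ + 1) ^ 2 / δL * Nr / Λ := by
    have hR0 : 0 < R₀ := lt_of_lt_of_le (by positivity) hR₀
    -- `(1/s₁ + 1) ≤ (x₁ + 1)/Λ`
    have hq : 1 / s₁ + 1 ≤ (x₁ + 1) / Λ := by
      rw [h1, add_div]; refine add_le_add le_rfl ?_; rw [le_div_iff₀ hΛ]; linarith
    have hq0 : 0 ≤ 1 / s₁ + 1 := by positivity
    -- `1 + s₁R₀ ≥ s₁R₀ = ΛR₀/x₁ ≥ ΛL/(10 Nr x₁)`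
    have hden : Λ * L / (10 * Nr * x₁) ≤ 1 + s₁ * R₀ := by
      rw [hs₁eq]
      have : Λ * L / (10 * Nr * x₁) ≤ Λ / x₁ * R₀ := by
        rw [div_mul_eq_mul_div, div_le_div_iff₀ (by positivity) hx₁0]
        have := mul_le_mul_of_nonneg_left hR₀ (by positivity : 0 ≤ Λ * x₁ * (10 * Nr))
        calc Λ * L * x₁ = Λ * x₁ * (10 * Nr) * (L / (10 * Nr)) := by field_simp
          _ ≤ Λ * x₁ * (10 * Nr) * R₀ := this
          _ = Λ * R₀ * (10 * Nr * x₁) := by ring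
      linarith
    have hden0 : 0 < Λ * L / (10 * Nr * x₁) := by positivity
    calc 16 * (1 / s₁ + 1) ^ 2 / (1 + s₁ * R₀) ≤ 16 * ((x₁ + 1) / Λ) ^ 2 / (Λ * L / (10 * Nr * x₁)) := by
          gcongr
      _ = 160 * x₁ * (x₁ + 1) ^ 2 * Nr / (Λ * (Λ ^ 2 * L)) := by field_simp; ring
      _ ≤ 160 * x₁ * (x₁ + 1) ^ 2 * Nr / (Λ * δL) := by
          exact div_le_div_of_nonneg_left (by positivity) (by positivity) (mul_le_mul_of_nonneg_left hΛL hΛ.le)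
      _ = 160 * x₁ * (x₁ + 1) ^ 2 / δL * Nr / Λ := by field_simp
  -- assemble
  have hbr : 4 * ((2 * Real.sqrt 2 / (s₂ * (Nr - 1)) + 2) * (2 * Real.sqrt 2 / (s₃ * (Nr - 1)) + 2)) + 16 * (1 / s₁ + 1) ^ 2 / (1 + s₁ * R₀) ≤
      (4 * ((2 * Real.sqrt 2 * x₂ + 2) * (2 * Real.sqrt 2 * x₃ + 1)) + 160 * x₁ * (x₁ + 1) ^ 2 / δL) * Nr / Λ := by
    have e : (4 * ((2 * Real.sqrt 2 * x₂ + 2) * (2 * Real.sqrt 2 * x₃ + 1)) + 160 * x₁ * (x₁ + 1) ^ 2 / δL) * Nr / Λ =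
        4 * ((2 * Real.sqrt 2 * x₂ + 2) * (2 * Real.sqrt 2 * x₃ + 1)) * Nr / Λ + 160 * x₁ * (x₁ + 1) ^ 2 / δL * Nr / Λ := by ring
    rw [e]; exact add_le_add hnear hfar
  have hbr0 : 0 ≤ 4 * ((2 * Real.sqrt 2 / (s₂ * (Nr - 1)) + 2) * (2 * Real.sqrt 2 / (s₃ * (Nr - 1)) + 2)) + 16 * (1 / s₁ + 1) ^ 2 / (1 + s₁ * R₀) := by
    have hR0 : 0 < R₀ := lt_of_lt_of_le (by positivity) hR₀
    positivity
  calc 2048 * (1 / s₀ + 1) * (4 * ((2 * Real.sqrt 2 / (s₂ * (Nr - 1)) + 2) * (2 * Real.sqrt 2 / (s₃ * (Nr - 1)) + 2)) +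
        16 * (1 / s₁ + 1) ^ 2 / (1 + s₁ * R₀))
      ≤ 2048 * (2 * (x₀ * Mβ / Λ)) * ((4 * ((2 * Real.sqrt 2 * x₂ + 2) * (2 * Real.sqrt 2 * x₃ + 1)) + 160 * x₁ * (x₁ + 1) ^ 2 / δL) * Nr / Λ) := by
        gcongr
    _ = 4096 * x₀ * (4 * ((2 * Real.sqrt 2 * x₂ + 2) * (2 * Real.sqrt 2 * x₃ + 1)) + 160 * x₁ * (x₁ + 1) ^ 2 / δL) * Mβ * Nr / Λ ^ 2 := by
        field_simp; ring

/-- **The fat support count in closed form**: with `π ≤ Λ_mβ`, `Λ_m = 4Λ`, `Λ_m + Kpρ_f² ≤ Λ·c₁`, `2ρ_f ≤ 2c_ρπ/N_r`, and the two thresholds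
absorbing the `+2`'s: `N̄_s ≤ 128·c₁·c_ρ/(π²γ) · βL²Λ²/N_r`. [folklore] -/
theorem fatSupport_le {Λ Λm β L γ Kp ρf cρ c₁ Nr : ℝ} (hΛ : 0 < Λ) (hβ : 0 < β) (hL : 0 < L) (hγ : 0 < γ) (hNr : 0 < Nr)
    (hc₁ : 0 ≤ c₁) (hΛm : Λm = 4 * Λ) (hπ : Real.pi ≤ Λm * β) (hsh : Λm + Kp * ρf ^ 2 ≤ Λ * c₁) (hρfb : ρf ≤ cρ * Real.pi / Nr)
    (hKρ : 0 ≤ Kp * ρf ^ 2)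
    (hY₁ : 2 ≤ Real.sqrt 2 * L * ((Λm + Kp * ρf ^ 2) / γ) / Real.pi) (hY₂ : 2 ≤ Real.sqrt 2 * L * (2 * ρf) / Real.pi) :
    (Λm * β / Real.pi + 1) * ((Real.sqrt 2 * L * ((Λm + Kp * ρf ^ 2) / γ) / Real.pi + 2) * (Real.sqrt 2 * L * (2 * ρf) / Real.pi + 2)) ≤
      128 * c₁ * cρ / (Real.pi ^ 2 * γ) * (β * L ^ 2 * Λ ^ 2 / Nr) := by
  have hπ0 := Real.pi_pos
  have hs2 : Real.sqrt 2 * Real.sqrt 2 = 2 := Real.mul_self_sqrt (by norm_num)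
  have hs0 : 0 ≤ Real.sqrt 2 := Real.sqrt_nonneg 2
  have h1 : Λm * β / Real.pi + 1 ≤ 2 * (Λm * β / Real.pi) := by
    have : 1 ≤ Λm * β / Real.pi := by rw [le_div_iff₀ hπ0]; linarith
    linarith
  have h2 : Real.sqrt 2 * L * ((Λm + Kp * ρf ^ 2) / γ) / Real.pi + 2 ≤ 2 * (Real.sqrt 2 * L * (Λ * c₁ / γ) / Real.pi) := by
    have : Real.sqrt 2 * L * ((Λm + Kp * ρf ^ 2) / γ) / Real.pi ≤ Real.sqrt 2 * L * (Λ * c₁ / γ) / Real.pi := by gcongr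
    linarith
  have h3 : Real.sqrt 2 * L * (2 * ρf) / Real.pi + 2 ≤ 2 * (Real.sqrt 2 * L * (2 * (cρ * Real.pi / Nr)) / Real.pi) := by
    have : Real.sqrt 2 * L * (2 * ρf) / Real.pi ≤ Real.sqrt 2 * L * (2 * (cρ * Real.pi / Nr)) / Real.pi := by gcongr
    linarith
  have h10 : 0 ≤ Λm * β / Real.pi + 1 := by rw [hΛm]; positivity
  have h20 : 0 ≤ Real.sqrt 2 * L * ((Λm + Kp * ρf ^ 2) / γ) / Real.pi + 2 := by rw [hΛm]; positivity
  have h30 : 0 ≤ Real.sqrt 2 * L * (2 * ρf) / Real.pi + 2 := by positivity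
  have h00 : 0 ≤ 2 * (Λm * β / Real.pi) := by rw [hΛm]; positivity
  calc _ ≤ (2 * (Λm * β / Real.pi)) * ((2 * (Real.sqrt 2 * L * (Λ * c₁ / γ) / Real.pi)) * (2 * (Real.sqrt 2 * L * (2 * (cρ * Real.pi / Nr)) / Real.pi))) :=
        mul_le_mul h1 (mul_le_mul h2 h3 h30 (by positivity)) (mul_nonneg h20 h30) h00
    _ = 128 * c₁ * cρ / (Real.pi ^ 2 * γ) * (β * L ^ 2 * Λ ^ 2 / Nr) := by
        have hs2sq : Real.sqrt 2 ^ 2 = 2 := by rw [pow_two]; exact hs2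
        rw [hΛm]; field_simp; ring_nf; rw [hs2sq]; ring

/-- **The final product**: if `W ≤ C_W·(M/β)·N_r/Λ²` and `N̄_s ≤ C_N·βL²Λ²/N_r`, then
`√W·√(16·2M·L²·N̄_s)·((βL²)⁻²·4βL²/Λ) ≤ 4√(32·C_W·C_N)·(M/β)/Λ`. [folklore] -/
theorem alphaProduct_le {W Ns CW CN M β L Λ Nr : ℝ} (hW0 : 0 ≤ W) (hNs0 : 0 ≤ Ns) (hCW : 0 ≤ CW) (hCN : 0 ≤ CN) (hM : 0 < M) (hβ : 0 < β)
    (hL : 0 < L) (hΛ : 0 < Λ) (hNr : 0 < Nr) (hW : W ≤ CW * (M / β) * Nr / Λ ^ 2) (hNs : Ns ≤ CN * (β * L ^ 2 * Λ ^ 2 / Nr)) :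
    Real.sqrt W * Real.sqrt (16 * (2 * M) * L ^ 2 * Ns) * ((1 / (β * L ^ 2)) ^ 2 * (4 * (β * L ^ 2) / Λ)) ≤
      4 * Real.sqrt (32 * CW * CN) * (M / β) / Λ := by
  have h1 : Real.sqrt W * Real.sqrt (16 * (2 * M) * L ^ 2 * Ns) = Real.sqrt (W * (16 * (2 * M) * L ^ 2 * Ns)) :=
    (Real.sqrt_mul hW0 _).symm
  rw [h1]
  have h2 : W * (16 * (2 * M) * L ^ 2 * Ns) ≤ (CW * (M / β) * Nr / Λ ^ 2) * (16 * (2 * M) * L ^ 2 * (CN * (β * L ^ 2 * Λ ^ 2 / Nr))) :=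
    mul_le_mul hW (by gcongr) (by positivity) (by positivity)
  have h3 : (CW * (M / β) * Nr / Λ ^ 2) * (16 * (2 * M) * L ^ 2 * (CN * (β * L ^ 2 * Λ ^ 2 / Nr))) = (Real.sqrt (32 * CW * CN) * M * L ^ 2) ^ 2 := by
    rw [mul_pow, mul_pow, Real.sq_sqrt (by positivity)]; field_simp; ring
  have h4 : Real.sqrt (W * (16 * (2 * M) * L ^ 2 * Ns)) ≤ Real.sqrt (32 * CW * CN) * M * L ^ 2 := by
    rw [← Real.sqrt_sq (by positivity : 0 ≤ Real.sqrt (32 * CW * CN) * M * L ^ 2), ← h3]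
    exact Real.sqrt_le_sqrt h2
  calc Real.sqrt (W * (16 * (2 * M) * L ^ 2 * Ns)) * ((1 / (β * L ^ 2)) ^ 2 * (4 * (β * L ^ 2) / Λ))
      ≤ (Real.sqrt (32 * CW * CN) * M * L ^ 2) * ((1 / (β * L ^ 2)) ^ 2 * (4 * (β * L ^ 2) / Λ)) :=
        mul_le_mul_of_nonneg_right h4 (by positivity)
    _ = 4 * Real.sqrt (32 * CW * CN) * (M / β) / Λ := by field_simp

end Summit.HubbardSuperconductivity.HubbardSuperconductivity.Theorems.TorusFourierL2

end
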